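import Literature.NumberTheory.Sieve.BombieriFriedlanderIwaniec
import Literature.NumberTheory.Sieve.BombieriVinogradovReduction
import Literature.NumberTheory.Sieve.PrimePowersInProgressions
import Literature.NumberTheory.LFunctions.PrimeNumberTheoremErrorTerm
import HarnessLib

/-!
# Bombieri–Friedlander–Iwaniec 1986, Theorem 10: reduction to dyadic intervals

Trunk `AntSieve`, companion to `Literature.NumberTheory.Sieve.BombieriFriedlanderIwaniec`.
Everything here is PROVED; the only named statement introduced, `Literature.NumberTheory.Sieve.BFI.Theorem10Dyadic`, is an
intermediate node of the DAG under `Literature.NumberTheory.Sieve.BombieriFriedlanderIwaniecTheorem10`.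

BFI open the proof of their prime-number theorems (§15, p. 244, first lines: "We first make the
trivial observation that it is enough to prove the following (15.1)") by replacing
`ψ(x; q, a) − x/φ(q)` with the *dyadic, balanced* discrepancy
`∑_{x ≤ n < 2x, n ≡ a (q)} Λ(n) − φ(q)⁻¹ ∑_{x ≤ n < 2x, (n, q) = 1} Λ(n)`, which is the shape the
bilinear Theorems 1, 2, 5* (see `…BombieriFriedlanderIwaniecDispersion`) produce.  This file carries
out that observation for Theorem 10 (well-factorable weights, level `x^{4/7−ε}`):

* `Literature.NumberTheory.Sieve.BFI.Theorem10Dyadic` — the dyadic form: for `a ≠ 0`, `ε > 0`, `A > 0` there are `C, x₀` with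
  `|∑_{q ≤ x^{4/7−ε}, (q,a)=1} λ(q) (∑_{x < n ≤ 2x, n ≡ a (q)} Λ(n) − φ(q)⁻¹ ∑_{x < n ≤ 2x, (n,q)=1} Λ(n))|
   ≤ C x (log x)^{−A}` for all `x ≥ x₀` and all well-factorable `λ` of level `x^{4/7−ε}`.
* `Literature.NumberTheory.Sieve.BombieriFriedlanderIwaniecTheorem10_of_dyadic` (PROVED):
  `Theorem10Dyadic → ChebyshevPsiDeLaValleePoussin → BombieriFriedlanderIwaniecTheorem10`.
* `Literature.BFI.Theorem10DyadicSifted z` — the same with the sifting condition `(n, P(z(x))) = 1` of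
  (15.1) on both sums (`BFI.IsRough`, `psiDyadModSifted`, `psiDyadCoprimeSifted`, `dyadDiscSifted`),
  for a sifting level `z : ℝ → ℝ` (BFI: `z = z₀ = exp(log x / log log x)`, (15.4)).
* `Literature.NumberTheory.Sieve.BFI.Theorem10Dyadic_of_sifted` (PROVED): for any `z(x) ≤ x` (eventually),
  `Theorem10DyadicSifted z → Theorem10Dyadic` (unsifting costs only proper prime powers, which are
  negligible by `Literature.NumberTheory.Sieve.eventually_sum_iSup_nonPrime_vonMangoldt_residue_le` and `ψ − ϑ ≪ √x log x`).

So the DAG under the tree's fact now reads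
`bfi_wellFactorable_level ⇐ BombieriFriedlanderIwaniecTheorem10 ⇐ Theorem10Dyadic ⇐ Theorem10DyadicSifted z`
(all arrows PROVED, the second using the PNT fact `ChebyshevPsiDeLaValleePoussin`), and
`Theorem10DyadicSifted z₀` is what §§15–17 of the source derive from Theorems 1, 2, 5*
(`Literature.NumberTheory.Sieve.BombieriFriedlanderIwaniecDispersion`).

## The argument

Fix `a, ε, A`, `x` large, `λ` well factorable of level `Q = x^{4/7−ε}`, and let `2^K ≍ (log x)^{A+3}`,
`y_k = x/2^k`.  Splitting `n ≤ x` at the points `y_K < y_{K−1} < ⋯ < y_0 = x`,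
`∑_q λ(q)(ψ(x;q,a) − x/φ(q)) = T₁ + T₂ + T₃` with
`T₁ = ∑_q λ(q) ψ(y_K; q, a)` (trivially `≪ (log x)(y_K log x + Q)`),
`T₂ = ∑_{k<K} ∑_q λ(q) E(y_{k+1}; q)` (the dyadic hypothesis at `y = y_{k+1}` with `ε/2`, `A + 2`,
after raising the level of `λ` from `x^{4/7−ε}` to `y^{4/7−ε/2}` by `IsWellFactorable.mono`; the
geometric series in `k` sums to `≪ x (log x)^{−A−2}`), and
`T₃ = ∑_q λ(q) φ(q)⁻¹ (∑_{y_K < n ≤ x, (n,q)=1} Λ(n) − x)`, where the bracket is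
`ψ(x) − x − ψ(y_K) − ∑_{y_K < n ≤ x, (n,q)>1} Λ(n) = O(x (log x)^{−A−2})` by the prime number theorem
(`ChebyshevPsiDeLaValleePoussin`), Chebyshev's bound and `∑_{n ≤ x, (n,q)>1} Λ(n) ≪ log q log x`,
while `∑_{q ≤ Q} 1/φ(q) ≤ (1 + log Q)²`.

## References

* E. Bombieri, J. B. Friedlander, H. Iwaniec, *Primes in arithmetic progressions to large moduli*,
  Acta Math. 156 (1986), 203–251, §15 (15.1) p. 244 and §17 p. 249. [BombieriFriedlanderIwaniecActa1986]
-/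

open Finset Real Filter
open scoped ArithmeticFunction.vonMangoldt Chebyshev

namespace Literature.NumberTheory.Sieve

namespace BFI

/-! ### Dyadic sums in progressions -/

/-- `∑_{x < n ≤ 2x, n ≡ a (mod q)} Λ(n)`, the von Mangoldt function summed over a dyadic interval in a
residue class (the first sum of BFI (15.1), p. 244, over `(x, 2x]`). [cite: BombieriFriedlanderIwaniecActa1986, §15 (15.1) p. 244] -/
noncomputable def psiDyadMod (q : ℕ) (a : ZMod q) (x : ℝ) : ℝ :=
  ∑ n ∈ Ioc ⌊x⌋₊ ⌊2 * x⌋₊, ArithmeticFunction.vonMangoldt.residueClass a n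

/-- `∑_{x < n ≤ 2x, (n, q) = 1} Λ(n)`, the coprime part of `ψ(2x) − ψ(x)` (the second sum of BFI
(15.1), p. 244, without the sifting condition). [cite: BombieriFriedlanderIwaniecActa1986, §15 (15.1) p. 244] -/
noncomputable def psiDyadCoprime (q : ℕ) (x : ℝ) : ℝ :=
  ∑ n ∈ Ioc ⌊x⌋₊ ⌊2 * x⌋₊, if n.Coprime q then Λ n else 0

/-- The dyadic balanced discrepancy
`E(x; q, a) = ∑_{x < n ≤ 2x, n ≡ a (q)} Λ(n) − φ(q)⁻¹ ∑_{x < n ≤ 2x, (n,q)=1} Λ(n)` (BFI (15.1), p. 244,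
with `z = 1`). [cite: BombieriFriedlanderIwaniecActa1986, §15 (15.1) p. 244] -/
noncomputable def dyadDisc (q : ℕ) (a : ℤ) (x : ℝ) : ℝ :=
  psiDyadMod q (a : ZMod q) x - psiDyadCoprime q x / (Nat.totient q : ℝ)

/-- **The dyadic form of BFI Theorem 10** (the shape of BFI (15.1), p. 244, for the well-factorable
weights of Theorem 10, §17): for `a ≠ 0`, `ε > 0`, `A > 0` there are `C, x₀` such that for all
`x ≥ x₀` and every well-factorable `λ` of level `x^{4/7−ε}`,
`|∑_{q ≤ x^{4/7−ε}, (q,a)=1} λ(q) E(x; q, a)| ≤ C x/(log x)^A`.  An intermediate statement (it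
follows from Theorems 1, 2, 5* by §§15, 17 of the source, and implies Theorem 10 by
`BombieriFriedlanderIwaniecTheorem10_of_dyadic` below); recorded as a named node of the DAG.
[cite: BombieriFriedlanderIwaniecActa1986, §15 (15.1) p. 244; §17 p. 249] -/
def Theorem10Dyadic : Prop :=
  ∀ a : ℤ, a ≠ 0 → ∀ ε : ℝ, 0 < ε → ∀ A : ℝ, 0 < A →
    ∃ C x₀ : ℝ, ∀ x : ℝ, x₀ ≤ x →
      ∀ lam : ℕ → ℝ, IsWellFactorable (x ^ (4 / 7 - ε)) lam →
        |∑ q ∈ (Icc 1 ⌊x ^ (4 / 7 - ε)⌋₊).filter (fun q : ℕ => IsCoprime (q : ℤ) a),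
            lam q * dyadDisc q a x| ≤ C * x / Real.log x ^ A

/-! ### Telescoping over dyadic intervals -/

/-- Splitting a sum over `n ≤ N` at `m ≤ N`: `∑_{n < N+1} f = ∑_{n < m+1} f + ∑_{m < n ≤ N} f`.
[folklore] -/
theorem sum_range_succ_eq_add_sum_Ioc (f : ℕ → ℝ) {m N : ℕ} (h : m ≤ N) :
    ∑ n ∈ range (N + 1), f n = ∑ n ∈ range (m + 1), f n + ∑ n ∈ Ioc m N, f n := by
  have hIoc : Ioc m N = Ico (m + 1) (N + 1) := by
    ext i; simp only [mem_Ioc, mem_Ico]; omega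
  rw [hIoc, Finset.range_eq_Ico, Finset.range_eq_Ico,
    Finset.sum_Ico_consecutive f (Nat.zero_le _) (by omega)]

/-- `2 · (x / 2^{k+1}) = x / 2^k`. [folklore] -/
theorem two_mul_div_pow_succ (x : ℝ) (k : ℕ) : 2 * (x / 2 ^ (k + 1)) = x / 2 ^ k := by
  rw [pow_succ]; field_simp

/-- One telescoping step for `ψ(·; q, a)`: `ψ(2y; q, a) = ψ(y; q, a) + ∑_{y < n ≤ 2y, n≡a} Λ(n)` for
`y ≥ 0`. [folklore] -/
theorem chebyshevPsiMod_two_mul (q : ℕ) (a : ZMod q) {y : ℝ} (hy : 0 ≤ y) :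
    LevelOfDistribution.chebyshevPsiMod q a (2 * y) = LevelOfDistribution.chebyshevPsiMod q a y + psiDyadMod q a y := by
  unfold LevelOfDistribution.chebyshevPsiMod psiDyadMod
  exact sum_range_succ_eq_add_sum_Ioc _ (Nat.floor_mono (by linarith))

/-- **Telescoping for `ψ(x; q, a)`**: `ψ(x; q, a) = ψ(x/2^K; q, a) + ∑_{k<K} ∑_{x/2^{k+1} < n ≤ x/2^k, n ≡ a} Λ(n)`
for `x ≥ 0`. [folklore] -/
theorem chebyshevPsiMod_eq_add_sum_psiDyadMod (q : ℕ) (a : ZMod q) {x : ℝ} (hx : 0 ≤ x) (K : ℕ) :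
    LevelOfDistribution.chebyshevPsiMod q a x =
      LevelOfDistribution.chebyshevPsiMod q a (x / 2 ^ K) + ∑ k ∈ range K, psiDyadMod q a (x / 2 ^ (k + 1)) := by
  induction K with
  | zero => simp
  | succ K ih =>
    rw [Finset.sum_range_succ, ih, ← two_mul_div_pow_succ x K,
      chebyshevPsiMod_two_mul q a (by positivity)]
    ring

/-- **Telescoping for the coprime sums**:
`∑_{k<K} ∑_{x/2^{k+1} < n ≤ x/2^k, (n,q)=1} Λ(n) = ∑_{x/2^K < n ≤ x, (n,q)=1} Λ(n)` for `x ≥ 0`. [folklore] -/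
theorem sum_psiDyadCoprime_eq (q : ℕ) {x : ℝ} (hx : 0 ≤ x) (K : ℕ) :
    ∑ k ∈ range K, psiDyadCoprime q (x / 2 ^ (k + 1)) =
      ∑ n ∈ Ioc ⌊x / 2 ^ K⌋₊ ⌊x⌋₊, if n.Coprime q then Λ n else 0 := by
  induction K with
  | zero => simp
  | succ K ih =>
    rw [Finset.sum_range_succ, ih, psiDyadCoprime, two_mul_div_pow_succ, add_comm]
    refine Finset.sum_Ioc_consecutive _ (Nat.floor_mono ?_) (Nat.floor_mono ?_)
    · exact div_le_div_of_nonneg_left hx (by positivity)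
        (pow_le_pow_right₀ one_le_two (Nat.le_succ K))
    · exact div_le_self hx (one_le_pow₀ (by norm_num))

/-! ### Trivial bounds -/

/-- `ψ(y; q, a) ≤ log y · (y/q + 1)` for `q ≥ 1`, `y ≥ 1`: each `Λ(n) ≤ log n ≤ log y`, and
`#{n ≤ y : n ≡ a (q)} ≤ y/q + 1`. [folklore] -/
theorem chebyshevPsiMod_le_log_mul {q : ℕ} (hq : 1 ≤ q) (a : ZMod q) {y : ℝ} (hy : 1 ≤ y) :
    LevelOfDistribution.chebyshevPsiMod q a y ≤ Real.log y * (y / q + 1) := by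
  have hy0 : 0 ≤ y := zero_le_one.trans hy
  have hlog0 : 0 ≤ Real.log y := Real.log_nonneg hy
  unfold LevelOfDistribution.chebyshevPsiMod
  calc ∑ n ∈ range (⌊y⌋₊ + 1), ArithmeticFunction.vonMangoldt.residueClass a n
      ≤ ∑ n ∈ range (⌊y⌋₊ + 1), (if (n : ZMod q) = a then Real.log y else 0) := by
        refine Finset.sum_le_sum fun n hn => ?_
        simp only [ArithmeticFunction.vonMangoldt.residueClass, Set.indicator_apply,
          Set.mem_setOf_eq]
        split_ifs with h
        · refine ArithmeticFunction.vonMangoldt_le_log.trans ?_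
          rcases Nat.eq_zero_or_pos n with rfl | hn0
          · simp [hlog0]
          · have hny : (n : ℝ) ≤ y :=
              (Nat.cast_le.2 (Nat.lt_succ_iff.1 (mem_range.1 hn))).trans (Nat.floor_le hy0)
            exact Real.log_le_log (by exact_mod_cast hn0) hny
        · exact le_rfl
    _ = Real.log y * #((range (⌊y⌋₊ + 1)).filter fun n : ℕ => (n : ZMod q) = a) := by
        rw [← Finset.sum_filter, Finset.sum_const, nsmul_eq_mul, mul_comm]
    _ ≤ Real.log y * (y / q + 1) := by
        refine mul_le_mul_of_nonneg_left ?_ hlog0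
        have h1 := card_range_filter_natCast_eq_le q a ⌊y⌋₊
        have h2 : ((⌊y⌋₊ / q : ℕ) : ℝ) ≤ y / q :=
          (Nat.cast_div_le).trans (div_le_div_of_nonneg_right (Nat.floor_le hy0) (by positivity))
        calc (#((range (⌊y⌋₊ + 1)).filter fun n : ℕ => (n : ZMod q) = a) : ℝ)
            ≤ ((⌊y⌋₊ / q + 1 : ℕ) : ℝ) := by exact_mod_cast h1
          _ ≤ y / q + 1 := by push_cast; linarith

/-- `T₁`: `|∑_{q ≤ Q, p q} λ(q) ψ(y; q, a)| ≤ log y · (y (1 + log Q) + Q)` for `|λ| ≤ 1`, `y ≥ 1`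
(`∑_{q ≤ Q} 1/q ≤ 1 + log Q`). [folklore] -/
theorem abs_sum_mul_chebyshevPsiMod_le (Qn : ℕ) (p : ℕ → Prop) [DecidablePred p] {lam : ℕ → ℝ}
    (hlam : ∀ q, |lam q| ≤ 1) (a : ℤ) {y : ℝ} (hy : 1 ≤ y) :
    |∑ q ∈ (Icc 1 Qn).filter p, lam q * LevelOfDistribution.chebyshevPsiMod q (a : ZMod q) y| ≤
      Real.log y * (y * (1 + Real.log Qn) + Qn) := by
  have hy0 : 0 ≤ y := zero_le_one.trans hy
  have hlog0 : 0 ≤ Real.log y := Real.log_nonneg hy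
  have hψ0 : ∀ q, 0 ≤ LevelOfDistribution.chebyshevPsiMod q (a : ZMod q) y := fun q =>
    Finset.sum_nonneg fun n _ => ArithmeticFunction.vonMangoldt.residueClass_nonneg _ _
  calc |∑ q ∈ (Icc 1 Qn).filter p, lam q * LevelOfDistribution.chebyshevPsiMod q (a : ZMod q) y|
      ≤ ∑ q ∈ (Icc 1 Qn).filter p, |lam q * LevelOfDistribution.chebyshevPsiMod q (a : ZMod q) y| :=
        Finset.abs_sum_le_sum_abs _ _
    _ ≤ ∑ q ∈ (Icc 1 Qn).filter p, LevelOfDistribution.chebyshevPsiMod q (a : ZMod q) y := by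
        refine Finset.sum_le_sum fun q _ => ?_
        rw [abs_mul, abs_of_nonneg (hψ0 q)]
        exact (mul_le_of_le_one_left (hψ0 q) (hlam q))
    _ ≤ ∑ q ∈ Icc 1 Qn, LevelOfDistribution.chebyshevPsiMod q (a : ZMod q) y :=
        Finset.sum_le_sum_of_subset_of_nonneg (Finset.filter_subset _ _) fun q _ _ => hψ0 q
    _ ≤ ∑ q ∈ Icc 1 Qn, Real.log y * (y / q + 1) :=
        Finset.sum_le_sum fun q hq => chebyshevPsiMod_le_log_mul (mem_Icc.1 hq).1 _ hy
    _ = Real.log y * (y * ∑ q ∈ Icc 1 Qn, ((q : ℝ))⁻¹ + Qn) := by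
        rw [← Finset.mul_sum, Finset.sum_add_distrib, Finset.mul_sum, Finset.sum_const,
          Nat.card_Icc, nsmul_eq_mul, mul_one]
        simp [div_eq_mul_inv]
    _ ≤ Real.log y * (y * (1 + Real.log Qn) + Qn) := by
        gcongr
        exact Literature.NumberTheory.Sieve.harmonic_Icc_le Qn

/-- The coprime sum over `(y, x]` against `x`: for `y ≤ x`,
`|∑_{y < n ≤ x, (n,q)=1} Λ(n) − x| ≤ |ψ(x) − x| + ψ(y) + ∑_{n ≤ x, (n,q)>1} Λ(n)`. [folklore] -/
theorem abs_sum_Ioc_coprime_sub_le (q : ℕ) {y x : ℝ} (hyx : y ≤ x) :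
    |(∑ n ∈ Ioc ⌊y⌋₊ ⌊x⌋₊, if n.Coprime q then Λ n else 0) - x| ≤
      |ψ x - x| + ψ y + Literature.NumberTheory.Sieve.nonCoprimePart q x := by
  set N : ℝ := ∑ n ∈ Ioc ⌊y⌋₊ ⌊x⌋₊, if n.Coprime q then 0 else Λ n with hN
  have hsplit : (∑ n ∈ Ioc ⌊y⌋₊ ⌊x⌋₊, if n.Coprime q then Λ n else 0) =
      (∑ n ∈ Ioc ⌊y⌋₊ ⌊x⌋₊, Λ n) - N := by
    rw [hN, ← Finset.sum_sub_distrib]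
    refine Finset.sum_congr rfl fun n _ => ?_
    split_ifs <;> ring
  have hpsi : (∑ n ∈ Ioc ⌊y⌋₊ ⌊x⌋₊, Λ n) = ψ x - ψ y := by
    rw [Chebyshev.psi, Chebyshev.psi, ← Finset.sum_Ioc_consecutive _ (Nat.zero_le ⌊y⌋₊)
      (Nat.floor_mono hyx)]
    ring
  have hN0 : 0 ≤ N := Finset.sum_nonneg fun n _ => by
    split_ifs
    · exact le_rfl
    · exact ArithmeticFunction.vonMangoldt_nonneg
  have hNle : N ≤ Literature.NumberTheory.Sieve.nonCoprimePart q x := by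
    rw [Literature.NumberTheory.Sieve.nonCoprimePart, Finset.sum_filter]
    have hsub : Ioc ⌊y⌋₊ ⌊x⌋₊ ⊆ range (⌊x⌋₊ + 1) := by
      intro n hn
      rw [mem_Ioc] at hn; rw [mem_range]; omega
    refine (Finset.sum_le_sum_of_subset_of_nonneg hsub ?_).trans (le_of_eq ?_)
    · intro n _ _
      split_ifs
      · exact le_rfl
      · exact ArithmeticFunction.vonMangoldt_nonneg
    · refine Finset.sum_congr rfl fun n _ => ?_
      split_ifs <;> simp_all
  have hψy : 0 ≤ ψ y := Chebyshev.psi_nonneg y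
  rw [hsplit, hpsi]
  calc |ψ x - ψ y - N - x| = |(ψ x - x) - (ψ y + N)| := by ring_nf
    _ ≤ |ψ x - x| + |ψ y + N| := abs_sub _ _
    _ ≤ |ψ x - x| + ψ y + Literature.NumberTheory.Sieve.nonCoprimePart q x := by
        rw [abs_of_nonneg (add_nonneg hψy hN0 : 0 ≤ ψ y + N)]; linarith

/-- `T₃`: for `|λ| ≤ 1`, `1 ≤ y ≤ x` and any `Q`:
`|∑_{q ≤ Q, p q} λ(q) (φ(q)⁻¹ ∑_{y<n≤x,(n,q)=1} Λ(n) − x/φ(q))| ≤ (1 + log Q)² (|ψ(x) − x| + ψ(y) + 2 log x · log Q)`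
(`∑_{q ≤ Q} 1/φ(q) ≤ (1 + log Q)²`, `∑_{n ≤ x, (n,q)>1} Λ(n) ≤ (log x/log 2) log q`). [folklore] -/
theorem abs_sum_mul_coprime_main_le (Qn : ℕ) (p : ℕ → Prop) [DecidablePred p] {lam : ℕ → ℝ}
    (hlam : ∀ q, |lam q| ≤ 1) {y x : ℝ} (hy : 1 ≤ y) (hyx : y ≤ x) :
    |∑ q ∈ (Icc 1 Qn).filter p, lam q *
        ((∑ n ∈ Ioc ⌊y⌋₊ ⌊x⌋₊, if n.Coprime q then Λ n else 0) / (Nat.totient q : ℝ) -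
          x / (Nat.totient q : ℝ))| ≤
      (1 + Real.log Qn) ^ 2 * (|ψ x - x| + ψ y + 2 * Real.log x * Real.log Qn) := by
  have hx1 : 1 ≤ x := hy.trans hyx
  have hlogx : 0 ≤ Real.log x := Real.log_nonneg hx1
  set B : ℝ := |ψ x - x| + ψ y + 2 * Real.log x * Real.log Qn with hB
  have hB0 : 0 ≤ B := by
    have := Chebyshev.psi_nonneg y
    have : 0 ≤ Real.log (Qn : ℝ) := Real.log_natCast_nonneg Qn
    positivity
  -- per modulus
  have hq : ∀ q ∈ (Icc 1 Qn).filter p,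
      |lam q * ((∑ n ∈ Ioc ⌊y⌋₊ ⌊x⌋₊, if n.Coprime q then Λ n else 0) / (Nat.totient q : ℝ) -
          x / (Nat.totient q : ℝ))| ≤ ((Nat.totient q : ℝ))⁻¹ * B := by
    intro q hq
    have hq1 : 1 ≤ q := (mem_Icc.1 (mem_filter.1 hq).1).1
    have hqQ : q ≤ Qn := (mem_Icc.1 (mem_filter.1 hq).1).2
    have hφ : 0 < (Nat.totient q : ℝ) := by exact_mod_cast Nat.totient_pos.2 hq1
    rw [← sub_div, abs_mul, abs_div, abs_of_pos hφ]
    calc |lam q| * (|(∑ n ∈ Ioc ⌊y⌋₊ ⌊x⌋₊, if n.Coprime q then Λ n else 0) - x| / (Nat.totient q))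
        ≤ 1 * (|(∑ n ∈ Ioc ⌊y⌋₊ ⌊x⌋₊, if n.Coprime q then Λ n else 0) - x| / (Nat.totient q)) :=
          mul_le_mul_of_nonneg_right (hlam q) (by positivity)
      _ ≤ B / Nat.totient q := by
          rw [one_mul]
          refine div_le_div_of_nonneg_right ?_ hφ.le
          refine (abs_sum_Ioc_coprime_sub_le q hyx).trans ?_
          rw [hB]
          gcongr
          refine (Literature.NumberTheory.Sieve.nonCoprimePart_le (by omega) (zero_le_one.trans hx1)).trans ?_
          have hlogq : Real.log q ≤ Real.log Qn :=
            Real.log_le_log (by exact_mod_cast hq1) (by exact_mod_cast hqQ)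
          have hlogq0 : 0 ≤ Real.log q := Real.log_natCast_nonneg q
          have hfl : (⌊Real.log x / Real.log 2⌋₊ : ℝ) ≤ 2 * Real.log x := by
            refine (Nat.floor_le (div_nonneg hlogx (Real.log_nonneg one_le_two))).trans ?_
            rw [div_le_iff₀ (Real.log_pos one_lt_two)]
            have := Real.log_two_gt_d9
            nlinarith
          calc (⌊Real.log x / Real.log 2⌋₊ : ℝ) * Real.log q ≤ 2 * Real.log x * Real.log q :=
                mul_le_mul_of_nonneg_right hfl hlogq0
            _ ≤ 2 * Real.log x * Real.log Qn := by gcongr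
      _ = ((Nat.totient q : ℝ))⁻¹ * B := by rw [div_eq_inv_mul]
  calc |∑ q ∈ (Icc 1 Qn).filter p, lam q *
          ((∑ n ∈ Ioc ⌊y⌋₊ ⌊x⌋₊, if n.Coprime q then Λ n else 0) / (Nat.totient q : ℝ) -
            x / (Nat.totient q : ℝ))|
      ≤ ∑ q ∈ (Icc 1 Qn).filter p, ((Nat.totient q : ℝ))⁻¹ * B :=
        (Finset.abs_sum_le_sum_abs _ _).trans (Finset.sum_le_sum hq)
    _ ≤ ∑ q ∈ Icc 1 Qn, ((Nat.totient q : ℝ))⁻¹ * B :=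
        Finset.sum_le_sum_of_subset_of_nonneg (Finset.filter_subset _ _) fun q _ _ => by
          positivity
    _ = Literature.NumberTheory.Sieve.totientInvSum Qn * B := by
        rw [Literature.NumberTheory.Sieve.totientInvSum, Finset.sum_mul]
    _ ≤ (1 + Real.log Qn) ^ 2 * B :=
        mul_le_mul_of_nonneg_right (Literature.NumberTheory.Sieve.totientInvSum_le Qn) hB0

/-- `T₂`, one dyadic piece: the dyadic hypothesis at `y` (slack `ε/2`, exponent `A + 2`) bounds the
`λ`-weighted sum of `E(y; q, a)` over `q ≤ x^{4/7−ε}` as soon as `x^{4/7−ε} ≤ y^{4/7−ε/2}` (the level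
of `λ` is raised by `IsWellFactorable.mono`, and `λ` vanishes above `x^{4/7−ε}`), and
`log y ≥ (log x)/2` converts `(log y)^{−A−2}` into `2^{A+2} (log x)^{−A−2}`. [folklore] -/
theorem abs_dyadic_piece_le {a : ℤ} {ε A C₁ x₁ : ℝ} (hC₁ : 0 ≤ C₁) (hA2 : 0 < A + 2)
    (hdy : ∀ y : ℝ, x₁ ≤ y → ∀ lam : ℕ → ℝ, IsWellFactorable (y ^ (4 / 7 - ε / 2)) lam →
      |∑ q ∈ (Icc 1 ⌊y ^ (4 / 7 - ε / 2)⌋₊).filter (fun q : ℕ => IsCoprime (q : ℤ) a),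
          lam q * dyadDisc q a y| ≤ C₁ * y / Real.log y ^ (A + 2))
    {x y : ℝ} (hx₁y : x₁ ≤ y) (hy0 : 0 ≤ y) (hlev1 : 1 ≤ x ^ (4 / 7 - ε))
    (hlev : x ^ (4 / 7 - ε) ≤ y ^ (4 / 7 - ε / 2)) (hlogx : 0 < Real.log x)
    (hlog : Real.log x / 2 ≤ Real.log y) {lam : ℕ → ℝ}
    (hlam : IsWellFactorable (x ^ (4 / 7 - ε)) lam) :
    |∑ q ∈ (Icc 1 ⌊x ^ (4 / 7 - ε)⌋₊).filter (fun q : ℕ => IsCoprime (q : ℤ) a),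
        lam q * dyadDisc q a y| ≤ C₁ * 2 ^ (A + 2) * y / Real.log x ^ (A + 2) := by
  have hlam' : IsWellFactorable (y ^ (4 / 7 - ε / 2)) lam := hlam.mono hlev1 hlev
  have hfl : ⌊x ^ (4 / 7 - ε)⌋₊ ≤ ⌊y ^ (4 / 7 - ε / 2)⌋₊ := Nat.floor_mono hlev
  rw [← hlam.sum_Icc_eq_sum_Icc_floor hfl (fun q : ℕ => IsCoprime (q : ℤ) a)
    (fun q => dyadDisc q a y)]
  refine (hdy y hx₁y lam hlam').trans ?_
  have hpow : Real.log x ^ (A + 2) / 2 ^ (A + 2) ≤ Real.log y ^ (A + 2) := by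
    rw [← Real.div_rpow hlogx.le zero_le_two]
    exact Real.rpow_le_rpow (by positivity) hlog hA2.le
  have hpos : 0 < Real.log x ^ (A + 2) / 2 ^ (A + 2) := by positivity
  calc C₁ * y / Real.log y ^ (A + 2) ≤ C₁ * y / (Real.log x ^ (A + 2) / 2 ^ (A + 2)) :=
        div_le_div_of_nonneg_left (by positivity) hpos hpow
    _ = C₁ * 2 ^ (A + 2) * y / Real.log x ^ (A + 2) := by
        field_simp

/-- `∑_{k<K} x/2^{k+1} = x (1 − 2^{−K})`. [folklore] -/
theorem sum_range_div_two_pow_succ (x : ℝ) (K : ℕ) :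
    ∑ k ∈ range K, x / 2 ^ (k + 1) = x * (1 - 1 / 2 ^ K) := by
  induction K with
  | zero => simp
  | succ K ih => rw [Finset.sum_range_succ, ih, pow_succ]; field_simp; ring

/-- The eventual inequalities in `x` used in the reduction (all of the type `(log x)^r ≤ x^s`).
[folklore] -/
theorem eventually_reduction_bounds (x₁ A : ℝ) {ε : ℝ} (hε : 0 < ε) :
    ∀ᶠ x : ℝ in atTop, 3 ≤ x ∧ 8 ≤ Real.log x ∧
      4 * max x₁ 2 * Real.log x ^ (A + 3) ≤ x ∧
      (2 * Real.log x ^ (A + 3)) ^ 2 ≤ x ∧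
      2 * Real.log x ^ (A + 3) ≤ x ^ (ε / 2) ∧
      Real.log x ^ (A + 1) ≤ x ^ (3 / 7 : ℝ) ∧
      8 * Real.log x ^ (A + 4) ≤ x := by
  filter_upwards [eventually_ge_atTop (3 : ℝ), Real.tendsto_log_atTop.eventually_ge_atTop 8,
    Real.tendsto_log_atTop.eventually_ge_atTop (4 * max x₁ 2),
    Literature.NumberTheory.Sieve.eventually_log_rpow_le_rpow (A + 4) one_pos,
    Literature.NumberTheory.Sieve.eventually_log_rpow_le_rpow (2 * A + 7) one_pos,
    Literature.NumberTheory.Sieve.eventually_log_rpow_le_rpow (A + 4) (half_pos hε),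
    Literature.NumberTheory.Sieve.eventually_log_rpow_le_rpow (A + 1) (by norm_num : (0 : ℝ) < 3 / 7),
    Literature.NumberTheory.Sieve.eventually_log_rpow_le_rpow (A + 5) one_pos] with x hx3 hL8 hLx₁ h1 h2 h3 h4 h5
  have hL0 : 0 < Real.log x := by linarith
  have hx1 : x ^ (1 : ℝ) = x := Real.rpow_one x
  have hsplit : ∀ r : ℝ, Real.log x ^ (r + 1) = Real.log x ^ r * Real.log x := fun r => by
    rw [Real.rpow_add hL0, Real.rpow_one]
  refine ⟨hx3, hL8, ?_, ?_, ?_, h4, ?_⟩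
  · -- 4 max(x₁,2) L^{A+3} ≤ L · L^{A+3} = L^{A+4} ≤ x
    rw [hx1] at h1
    calc 4 * max x₁ 2 * Real.log x ^ (A + 3) ≤ Real.log x * Real.log x ^ (A + 3) :=
          mul_le_mul_of_nonneg_right hLx₁ (by positivity)
      _ = Real.log x ^ (A + 4) := by rw [show A + 4 = (A + 3) + 1 by ring, hsplit]; ring
      _ ≤ x := h1
  · -- (2 L^{A+3})² = 4 L^{2A+6} ≤ L^{2A+7} ≤ x
    rw [hx1] at h2
    calc (2 * Real.log x ^ (A + 3)) ^ 2 = 4 * (Real.log x ^ (A + 3) * Real.log x ^ (A + 3)) := by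
          ring
      _ = 4 * Real.log x ^ (2 * A + 6) := by rw [← Real.rpow_add hL0]; ring_nf
      _ ≤ Real.log x * Real.log x ^ (2 * A + 6) :=
          mul_le_mul_of_nonneg_right (by linarith) (by positivity)
      _ = Real.log x ^ (2 * A + 7) := by
          rw [show 2 * A + 7 = (2 * A + 6) + 1 by ring, hsplit]; ring
      _ ≤ x := h2
  · -- 2 L^{A+3} ≤ L^{A+4} ≤ x^{ε/2}
    calc 2 * Real.log x ^ (A + 3) ≤ Real.log x * Real.log x ^ (A + 3) :=
          mul_le_mul_of_nonneg_right (by linarith) (by positivity)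
      _ = Real.log x ^ (A + 4) := by rw [show A + 4 = (A + 3) + 1 by ring, hsplit]; ring
      _ ≤ x ^ (ε / 2) := h3
  · -- 8 L^{A+4} ≤ L^{A+5} ≤ x
    rw [hx1] at h5
    calc 8 * Real.log x ^ (A + 4) ≤ Real.log x * Real.log x ^ (A + 4) :=
          mul_le_mul_of_nonneg_right hL8 (by positivity)
      _ = Real.log x ^ (A + 5) := by rw [show A + 5 = (A + 4) + 1 by ring, hsplit]; ring
      _ ≤ x := h5

/-! ### The sifted dyadic sums of BFI (15.1) -/

/-- `n` is `z`-rough: every prime factor `p` of `n` satisfies `z ≤ p`, i.e. `(n, P(z)) = 1` with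
`P(z) = ∏_{p<z} p` (BFI §12 p. 237, §15 (15.1) p. 244). [cite: BombieriFriedlanderIwaniecActa1986, §15 (15.1) p. 244] -/
def IsRough (z : ℝ) (n : ℕ) : Prop :=
  ∀ p ∈ n.primeFactors, z ≤ (p : ℝ)

/-- `IsRough z n` is decidable (a bounded quantifier over `n.primeFactors`; classical on `ℝ`). [folklore] -/
noncomputable instance instDecidableIsRough (z : ℝ) (n : ℕ) : Decidable (IsRough z n) := by
  unfold IsRough; infer_instance

/-- A prime `n > x ≥ z` is `z`-rough; so a non-`z`-rough `n ∈ (x, 2x]` (`z ≤ x`) is not prime. [folklore] -/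
theorem not_prime_of_not_isRough {z x : ℝ} (hzx : z ≤ x) {n : ℕ} (hn : n ∈ Ioc ⌊x⌋₊ ⌊2 * x⌋₊)
    (h : ¬IsRough z n) : ¬n.Prime := by
  intro hp
  apply h
  intro p hpmem
  rw [hp.primeFactors, Finset.mem_singleton] at hpmem
  subst hpmem
  have : x < (p : ℕ) := Nat.lt_of_floor_lt (mem_Ioc.1 hn).1
  exact (hzx.trans this.le)

/-- `∑_{x < n ≤ 2x, n ≡ a (q), (n, P(z)) = 1} Λ(n)` (the first sum of BFI (15.1), p. 244, over
`(x, 2x]`). [cite: BombieriFriedlanderIwaniecActa1986, §15 (15.1) p. 244] -/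
noncomputable def psiDyadModSifted (q : ℕ) (a : ZMod q) (z x : ℝ) : ℝ :=
  ∑ n ∈ Ioc ⌊x⌋₊ ⌊2 * x⌋₊,
    if IsRough z n then ArithmeticFunction.vonMangoldt.residueClass a n else 0

/-- `∑_{x < n ≤ 2x, (n, q P(z)) = 1} Λ(n)` (the second sum of BFI (15.1), p. 244, over `(x, 2x]`).
[cite: BombieriFriedlanderIwaniecActa1986, §15 (15.1) p. 244] -/
noncomputable def psiDyadCoprimeSifted (q : ℕ) (z x : ℝ) : ℝ :=
  ∑ n ∈ Ioc ⌊x⌋₊ ⌊2 * x⌋₊, if n.Coprime q ∧ IsRough z n then Λ n else 0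

/-- The sifted dyadic discrepancy of BFI (15.1), p. 244:
`E_z(x; q, a) = ∑_{x<n≤2x, n≡a(q), (n,P(z))=1} Λ(n) − φ(q)⁻¹ ∑_{x<n≤2x, (n,qP(z))=1} Λ(n)`.
[cite: BombieriFriedlanderIwaniecActa1986, §15 (15.1) p. 244] -/
noncomputable def dyadDiscSifted (q : ℕ) (a : ℤ) (z x : ℝ) : ℝ :=
  psiDyadModSifted q (a : ZMod q) z x - psiDyadCoprimeSifted q z x / (Nat.totient q : ℝ)

/-- **The sifted dyadic form of BFI Theorem 10** — the shape of BFI (15.1) (p. 244) for the weights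
of Theorem 10, with a sifting level `z = z(x)` (BFI take `z = z₀ = exp(log x / log log x)`, (15.4),
"but, in fact, any number `z` with `N₀ < z < z₀` would be equally good"): for `a ≠ 0`, `ε > 0`,
`A > 0` there are `C, x₀` with
`|∑_{q ≤ x^{4/7−ε}, (q,a)=1} λ(q) E_{z(x)}(x; q, a)| ≤ C x/(log x)^A` for `x ≥ x₀` and every
well-factorable `λ` of level `x^{4/7−ε}`.  An intermediate node of the DAG (to be derived from
Theorems 1, 2, 5* along §§15, 17); it implies `Theorem10Dyadic` for any `z(x) ≤ x`
(`Theorem10Dyadic_of_sifted`). [cite: BombieriFriedlanderIwaniecActa1986, §15 (15.1), (15.4) p. 244] -/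
def Theorem10DyadicSifted (z : ℝ → ℝ) : Prop :=
  ∀ a : ℤ, a ≠ 0 → ∀ ε : ℝ, 0 < ε → ∀ A : ℝ, 0 < A →
    ∃ C x₀ : ℝ, ∀ x : ℝ, x₀ ≤ x →
      ∀ lam : ℕ → ℝ, IsWellFactorable (x ^ (4 / 7 - ε)) lam →
        |∑ q ∈ (Icc 1 ⌊x ^ (4 / 7 - ε)⌋₊).filter (fun q : ℕ => IsCoprime (q : ℤ) a),
            lam q * dyadDiscSifted q a (z x) x| ≤ C * x / Real.log x ^ A

/-- Unsifting the progression sum costs only non-prime prime powers: for `z ≤ x`,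
`0 ≤ ∑_{x<n≤2x, n≡a} Λ(n) − ∑_{x<n≤2x, n≡a, (n,P(z))=1} Λ(n) ≤ ∑_{n ≤ 2x, n ≡ a, n not prime} Λ(n)`.
[folklore] -/
theorem psiDyadMod_sub_sifted_le {z x : ℝ} (hzx : z ≤ x) (q : ℕ) (a : ZMod q) :
    0 ≤ psiDyadMod q a x - psiDyadModSifted q a z x ∧
      psiDyadMod q a x - psiDyadModSifted q a z x ≤
        ∑ n ∈ range (⌊2 * x⌋₊ + 1),
          (if n.Prime then 0 else if (n : ZMod q) = a then Λ n else 0) := by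
  have hsub : psiDyadMod q a x - psiDyadModSifted q a z x =
      ∑ n ∈ Ioc ⌊x⌋₊ ⌊2 * x⌋₊,
        (if IsRough z n then 0 else ArithmeticFunction.vonMangoldt.residueClass a n) := by
    rw [psiDyadMod, psiDyadModSifted, ← Finset.sum_sub_distrib]
    refine Finset.sum_congr rfl fun n _ => ?_
    split_ifs <;> ring
  rw [hsub]
  refine ⟨Finset.sum_nonneg fun n _ => ?_, ?_⟩
  · split_ifs
    · exact le_rfl
    · exact ArithmeticFunction.vonMangoldt.residueClass_nonneg _ _
  have hsubset : Ioc ⌊x⌋₊ ⌊2 * x⌋₊ ⊆ range (⌊2 * x⌋₊ + 1) := fun n hn => by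
    rw [mem_Ioc] at hn; rw [mem_range]; omega
  refine (Finset.sum_le_sum fun n hn => ?_).trans
    (Finset.sum_le_sum_of_subset_of_nonneg hsubset fun n _ _ => ?_)
  · -- termwise on `(x, 2x]`
    by_cases hr : IsRough z n
    · rw [if_pos hr]
      split_ifs <;> first | exact le_rfl | exact ArithmeticFunction.vonMangoldt_nonneg
    · rw [if_neg hr, if_neg (not_prime_of_not_isRough hzx hn hr)]
      simp only [ArithmeticFunction.vonMangoldt.residueClass, Set.indicator_apply,
        Set.mem_setOf_eq]
      exact le_rfl
  · split_ifs <;> first | exact le_rfl | exact ArithmeticFunction.vonMangoldt_nonneg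

/-- Unsifting the coprime sum: for `z ≤ x`,
`0 ≤ ∑_{x<n≤2x,(n,q)=1} Λ(n) − ∑_{x<n≤2x,(n,qP(z))=1} Λ(n) ≤ ψ(2x) − ϑ(2x)`. [folklore] -/
theorem psiDyadCoprime_sub_sifted_le {z x : ℝ} (hzx : z ≤ x) (q : ℕ) :
    0 ≤ psiDyadCoprime q x - psiDyadCoprimeSifted q z x ∧
      psiDyadCoprime q x - psiDyadCoprimeSifted q z x ≤ ψ (2 * x) - θ (2 * x) := by
  have hsub : psiDyadCoprime q x - psiDyadCoprimeSifted q z x =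
      ∑ n ∈ Ioc ⌊x⌋₊ ⌊2 * x⌋₊, (if n.Coprime q ∧ ¬IsRough z n then Λ n else 0) := by
    rw [psiDyadCoprime, psiDyadCoprimeSifted, ← Finset.sum_sub_distrib]
    refine Finset.sum_congr rfl fun n _ => ?_
    by_cases h1 : n.Coprime q <;> by_cases h2 : IsRough z n <;> simp [h1, h2]
  rw [hsub, Chebyshev.psi_sub_theta_eq_sum_not_prime, Finset.sum_filter]
  refine ⟨Finset.sum_nonneg fun n _ => ?_, ?_⟩
  · split_ifs <;> first | exact le_rfl | exact ArithmeticFunction.vonMangoldt_nonneg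
  have hsubset : Ioc ⌊x⌋₊ ⌊2 * x⌋₊ ⊆ Ioc 0 ⌊2 * x⌋₊ := fun n hn => by
    rw [mem_Ioc] at hn ⊢; omega
  refine (Finset.sum_le_sum fun n hn => ?_).trans
    (Finset.sum_le_sum_of_subset_of_nonneg hsubset fun n _ _ => ?_)
  · by_cases h : n.Coprime q ∧ ¬IsRough z n
    · rw [if_pos h, if_pos (not_prime_of_not_isRough hzx hn h.2)]
    · rw [if_neg h]
      split_ifs <;> first | exact le_rfl | exact ArithmeticFunction.vonMangoldt_nonneg
  · split_ifs <;> first | exact le_rfl | exact ArithmeticFunction.vonMangoldt_nonneg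

/-- The cost of unsifting one modulus: for `z ≤ x` and `q ≥ 1`,
`|E(x; q, a) − E_z(x; q, a)| ≤ ∑_{n ≤ 2x, n≡a, n not prime} Λ(n) + (ψ(2x) − ϑ(2x))/φ(q)`. [folklore] -/
theorem abs_dyadDisc_sub_sifted_le {z x : ℝ} (hzx : z ≤ x) {q : ℕ} (hq : 1 ≤ q) (a : ℤ) :
    |dyadDisc q a x - dyadDiscSifted q a z x| ≤
      (∑ n ∈ range (⌊2 * x⌋₊ + 1),
          (if n.Prime then 0 else if (n : ZMod q) = (a : ZMod q) then Λ n else 0)) +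
        (ψ (2 * x) - θ (2 * x)) / (Nat.totient q : ℝ) := by
  obtain ⟨h1, h2⟩ := psiDyadMod_sub_sifted_le hzx q (a : ZMod q)
  obtain ⟨h3, h4⟩ := psiDyadCoprime_sub_sifted_le hzx q
  have hφ : 0 < (Nat.totient q : ℝ) := by exact_mod_cast Nat.totient_pos.2 hq
  have heq : dyadDisc q a x - dyadDiscSifted q a z x =
      (psiDyadMod q (a : ZMod q) x - psiDyadModSifted q (a : ZMod q) z x) -
        (psiDyadCoprime q x - psiDyadCoprimeSifted q z x) / (Nat.totient q : ℝ) := by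
    unfold dyadDisc dyadDiscSifted; ring
  rw [heq]
  refine (abs_sub _ _).trans (add_le_add ?_ ?_)
  · rwa [abs_of_nonneg h1]
  · rw [abs_of_nonneg (div_nonneg h3 hφ.le)]
    exact div_le_div_of_nonneg_right h4 hφ.le

/-! ### Real-arithmetic steps of the reduction -/

/-- Arithmetic of `T₁`: with `yK ≤ x/L^{A+3}`, `Q ≤ x^{4/7}`, `L^{A+1} ≤ x^{3/7}` and all logarithms
`≤ L`, `log yK · (yK (1 + log Q) + Q) ≤ 3 x / L^A`. [folklore] -/
theorem reduction_T1_arith {A L x yK Qr : ℝ} (hL0 : 0 < L) (hL1 : 1 ≤ L) (hx1 : 1 ≤ x)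
    (hyK0 : 0 ≤ yK) (hyKup : yK ≤ x / L ^ (A + 3)) (hlogyK : Real.log yK ≤ L)
    (hQ0 : 0 ≤ Qr) (hQ : Qr ≤ x ^ (4 / 7 : ℝ))
    (hlogQ : Real.log Qr ≤ L) (hlogQ0 : 0 ≤ Real.log Qr) (he4 : L ^ (A + 1) ≤ x ^ (3 / 7 : ℝ)) :
    Real.log yK * (yK * (1 + Real.log Qr) + Qr) ≤ 3 * x / L ^ A := by
  have hLA0 : 0 < L ^ A := Real.rpow_pos_of_pos hL0 A
  have hLA1 : L ^ (A + 1) = L ^ A * L := by rw [Real.rpow_add hL0, Real.rpow_one]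
  have hLA3 : L ^ (A + 3) = L ^ A * L ^ 3 := by
    rw [Real.rpow_add hL0, show (3 : ℝ) = ((3 : ℕ) : ℝ) by norm_num, Real.rpow_natCast]
  have hx47 : L * x ^ (4 / 7 : ℝ) ≤ x / L ^ A := by
    rw [le_div_iff₀ hLA0]
    have : x = x ^ (3 / 7 : ℝ) * x ^ (4 / 7 : ℝ) := by
      rw [← Real.rpow_add (by linarith : (0 : ℝ) < x)]; norm_num
    calc L * x ^ (4 / 7 : ℝ) * L ^ A = L ^ (A + 1) * x ^ (4 / 7 : ℝ) := by rw [hLA1]; ring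
      _ ≤ x ^ (3 / 7 : ℝ) * x ^ (4 / 7 : ℝ) := mul_le_mul_of_nonneg_right he4 (by positivity)
      _ = x := this.symm
  have h1 : Real.log yK * (yK * (1 + Real.log Qr) + Qr) ≤ L * (yK * (2 * L) + x ^ (4 / 7 : ℝ)) := by
    have : yK * (1 + Real.log Qr) ≤ yK * (2 * L) := mul_le_mul_of_nonneg_left (by linarith) hyK0
    calc Real.log yK * (yK * (1 + Real.log Qr) + Qr) ≤ L * (yK * (1 + Real.log Qr) + Qr) :=
          mul_le_mul_of_nonneg_right hlogyK (add_nonneg (mul_nonneg hyK0 (by linarith)) hQ0)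
      _ ≤ L * (yK * (2 * L) + x ^ (4 / 7 : ℝ)) := by gcongr
  refine h1.trans ?_
  have h2 : L * (yK * (2 * L)) ≤ 2 * x / L ^ A := by
    have hy' : yK ≤ x / (L ^ A * L ^ 3) := by rw [← hLA3]; exact hyKup
    have hL3 : L ^ 2 ≤ L ^ 3 := by nlinarith
    calc L * (yK * (2 * L)) = 2 * L ^ 2 * yK := by ring
      _ ≤ 2 * L ^ 2 * (x / (L ^ A * L ^ 3)) := by gcongr
      _ = 2 * x / L ^ A * (L ^ 2 / L ^ 3) := by field_simp
      _ ≤ 2 * x / L ^ A * 1 := by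
          refine mul_le_mul_of_nonneg_left ?_ (by positivity)
          rwa [div_le_one (by positivity)]
      _ = 2 * x / L ^ A := mul_one _
  calc L * (yK * (2 * L) + x ^ (4 / 7 : ℝ)) = L * (yK * (2 * L)) + L * x ^ (4 / 7 : ℝ) := by ring
    _ ≤ 2 * x / L ^ A + x / L ^ A := add_le_add h2 hx47
    _ = 3 * x / L ^ A := by ring

/-- Arithmetic of `T₂`: `C 2^{A+2} L^{−A−2} · x (1 − 2^{−K}) ≤ C 2^{A+2} x L^{−A}` for `L ≥ 1`. [folklore] -/
theorem reduction_T2_arith {A L x C : ℝ} (K : ℕ) (hL0 : 0 < L) (hL1 : 1 ≤ L) (hx0 : 0 ≤ x)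
    (hC : 0 ≤ C) :
    C * 2 ^ (A + 2) / L ^ (A + 2) * (x * (1 - 1 / 2 ^ K)) ≤ C * 2 ^ (A + 2) * x / L ^ A := by
  have hLA0 : 0 < L ^ A := Real.rpow_pos_of_pos hL0 A
  have hLA2 : L ^ (A + 2) = L ^ A * L ^ 2 := by rw [Real.rpow_add hL0, Real.rpow_two]
  have hgeo : x * (1 - 1 / 2 ^ K) ≤ x := by
    have : 0 ≤ 1 / (2 : ℝ) ^ K := by positivity
    nlinarith
  calc C * 2 ^ (A + 2) / L ^ (A + 2) * (x * (1 - 1 / 2 ^ K))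
      ≤ C * 2 ^ (A + 2) / L ^ (A + 2) * x := mul_le_mul_of_nonneg_left hgeo (by positivity)
    _ = C * 2 ^ (A + 2) * x / L ^ A * (1 / L ^ 2) := by rw [hLA2]; field_simp
    _ ≤ C * 2 ^ (A + 2) * x / L ^ A * 1 := by
        refine mul_le_mul_of_nonneg_left ?_ (by positivity)
        rw [div_le_one (by positivity)]; nlinarith
    _ = C * 2 ^ (A + 2) * x / L ^ A := mul_one _

/-- Arithmetic of `T₃`: with `|ψ(x) − x| ≤ C x/L^{A+2}`, `ψ(yK) ≤ 7x/L^{A+3}`, `log Q ≤ L`,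
`8 L^{A+4} ≤ x`: `(1 + log Q)² (|ψ(x) − x| + ψ(yK) + 2 L log Q) ≤ (4C + 29) x / L^A`. [folklore] -/
theorem reduction_T3_arith {A L x yK Qr C : ℝ} (hL0 : 0 < L) (hL1 : 1 ≤ L) (hx0 : 0 ≤ x)
    (hψx : |ψ x - x| ≤ C * x / L ^ (A + 2)) (hψyK : ψ yK ≤ 7 * (x / L ^ (A + 3))) (hlogQ : Real.log Qr ≤ L) (hlogQ0 : 0 ≤ Real.log Qr)
    (he5 : 8 * L ^ (A + 4) ≤ x) :
    (1 + Real.log Qr) ^ 2 * (|ψ x - x| + ψ yK + 2 * L * Real.log Qr) ≤ (4 * C + 29) * x / L ^ A := by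
  have hLA0 : 0 < L ^ A := Real.rpow_pos_of_pos hL0 A
  have hLA2 : L ^ (A + 2) = L ^ A * L ^ 2 := by rw [Real.rpow_add hL0, Real.rpow_two]
  have hLA3 : L ^ (A + 3) = L ^ A * L ^ 3 := by
    rw [Real.rpow_add hL0, show (3 : ℝ) = ((3 : ℕ) : ℝ) by norm_num, Real.rpow_natCast]
  have hLA4 : L ^ (A + 4) = L ^ A * L ^ 4 := by
    rw [Real.rpow_add hL0, show (4 : ℝ) = ((4 : ℕ) : ℝ) by norm_num, Real.rpow_natCast]
  have hsq : (1 + Real.log Qr) ^ 2 ≤ 4 * L ^ 2 := by nlinarith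
  have hB : |ψ x - x| + ψ yK + 2 * L * Real.log Qr ≤
      C * x / L ^ (A + 2) + 7 * (x / L ^ (A + 3)) + 2 * L ^ 2 := by
    have : 2 * L * Real.log Qr ≤ 2 * L ^ 2 := by nlinarith
    linarith
  have hB0 : 0 ≤ |ψ x - x| + ψ yK + 2 * L * Real.log Qr := by positivity
  calc (1 + Real.log Qr) ^ 2 * (|ψ x - x| + ψ yK + 2 * L * Real.log Qr)
      ≤ 4 * L ^ 2 * (C * x / L ^ (A + 2) + 7 * (x / L ^ (A + 3)) + 2 * L ^ 2) :=
        mul_le_mul hsq hB hB0 (by positivity)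
    _ = 4 * C * x / L ^ A + 28 * x / L ^ A * (L ^ 2 / L ^ 3) + 8 * L ^ 4 := by
        rw [hLA2, hLA3]; field_simp; ring
    _ ≤ 4 * C * x / L ^ A + 28 * x / L ^ A * 1 + x / L ^ A := by
        have hL3 : L ^ 2 ≤ L ^ 3 := by nlinarith
        refine add_le_add (add_le_add le_rfl (mul_le_mul_of_nonneg_left ?_ (by positivity))) ?_
        · rwa [div_le_one (by positivity)]
        · rw [le_div_iff₀ hLA0]
          calc 8 * L ^ 4 * L ^ A = 8 * L ^ (A + 4) := by rw [hLA4]; ring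
            _ ≤ x := he5
    _ = (4 * C + 29) * x / L ^ A := by ring

/-- The choice of the dyadic depth: for `T ≥ 1` there is `K` with `T < 2^K ≤ 2T`. [folklore] -/
theorem exists_pow_two_near {T : ℝ} (hT : 1 ≤ T) : ∃ K : ℕ, T < (2 : ℝ) ^ K ∧ (2 : ℝ) ^ K ≤ 2 * T := by
  set F : ℕ := ⌊T⌋₊ with hF
  have hF0 : F ≠ 0 := Nat.pos_iff_ne_zero.1 (Nat.floor_pos.2 hT)
  refine ⟨Nat.log 2 F + 1, ?_, ?_⟩
  · have h1 : F < 2 ^ (Nat.log 2 F + 1) := Nat.lt_pow_succ_log_self one_lt_two F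
    calc T < (F : ℝ) + 1 := Nat.lt_floor_add_one _
      _ ≤ ((2 ^ (Nat.log 2 F + 1) : ℕ) : ℝ) := by exact_mod_cast h1
      _ = (2 : ℝ) ^ (Nat.log 2 F + 1) := by norm_cast
  · have h1 : 2 ^ Nat.log 2 F ≤ F := Nat.pow_log_le_self 2 hF0
    calc (2 : ℝ) ^ (Nat.log 2 F + 1) = 2 * ((2 ^ Nat.log 2 F : ℕ) : ℝ) := by
          rw [pow_succ]; push_cast; ring
      _ ≤ 2 * (F : ℝ) := by gcongr
      _ ≤ 2 * T := by gcongr; exact Nat.floor_le (by linarith)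

end BFI

open BFI

/-! ### The reduction -/

/-- **BFI Theorem 10 from its dyadic form** (the "trivial observation" opening §15 of the source,
p. 244, carried out for the well-factorable weights of Theorem 10): the dyadic balanced estimate
`BFI.Theorem10Dyadic` and the prime number theorem with the de la Vallée Poussin error term imply
`BombieriFriedlanderIwaniecTheorem10` (the `ψ`-form with main term `x/φ(q)`).  PROVED; see the
module docstring for the decomposition `T₁ + T₂ + T₃`.
[cite: BombieriFriedlanderIwaniecActa1986, §15 (15.1) p. 244; §17 p. 249] -/
theorem BombieriFriedlanderIwaniecTheorem10_of_dyadic (h : Theorem10Dyadic)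
    (hψ : LFunctions.ChebyshevPsiDeLaValleePoussin) : BombieriFriedlanderIwaniecTheorem10 := by
  intro a ha ε hε A hA
  -- Case `ε > 4/7`: there are no moduli `1 ≤ q ≤ x^{4/7−ε} < 1`.
  by_cases hε47 : 4 / 7 < ε
  · refine ⟨0, 2, fun x hx lam _ => ?_⟩
    have hQ : ⌊x ^ (4 / 7 - ε)⌋₊ = 0 :=
      Nat.floor_eq_zero.2 (Real.rpow_lt_one_of_one_lt_of_neg (by linarith) (by linarith))
    rw [hQ]
    simp
  push Not at hε47
  -- Main case `ε ≤ 4/7`.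
  obtain ⟨C₁, x₁, hC₁⟩ := h a ha (ε / 2) (half_pos hε) (A + 2) (by linarith)
  obtain ⟨CP, hCP⟩ := hψ.logPow (A + 2)
  set C₁' : ℝ := max C₁ 0 with hC₁'
  set CP' : ℝ := max CP 0 with hCP'
  have hC₁'0 : 0 ≤ C₁' := le_max_right _ _
  have hCP'0 : 0 ≤ CP' := le_max_right _ _
  obtain ⟨x₀, hx₀⟩ := Filter.eventually_atTop.1 (eventually_reduction_bounds x₁ A hε)
  refine ⟨C₁' * 2 ^ (A + 2) + 4 * CP' + 32, x₀, fun x hx lam hlam => ?_⟩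
  obtain ⟨hx3, hL8, he1, he2, he3, he4, he5⟩ := hx₀ x hx
  -- notation
  set L : ℝ := Real.log x with hL
  set c : ℝ := 4 / 7 - ε with hc
  set Qn : ℕ := ⌊x ^ c⌋₊ with hQn
  set S : Finset ℕ := (Icc 1 Qn).filter (fun q : ℕ => IsCoprime (q : ℤ) a) with hS
  have hx1 : (1 : ℝ) ≤ x := by linarith
  have hx0 : (0 : ℝ) ≤ x := by linarith
  have hL0 : 0 < L := by linarith
  have hL1 : 1 ≤ L := by linarith
  have hc0 : 0 ≤ c := by rw [hc]; linarith
  have hc1 : c ≤ 1 := by rw [hc]; linarith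
  have hxc1 : 1 ≤ x ^ c := Real.one_le_rpow hx1 hc0
  have hxcx : x ^ c ≤ x := by
    conv_rhs => rw [← Real.rpow_one x]
    exact Real.rpow_le_rpow_of_exponent_le hx1 hc1
  have hQnx : (Qn : ℝ) ≤ x ^ c := Nat.floor_le (by positivity)
  have hQ47 : (Qn : ℝ) ≤ x ^ (4 / 7 : ℝ) :=
    hQnx.trans (Real.rpow_le_rpow_of_exponent_le hx1 (by rw [hc]; linarith))
  have hlogQn : Real.log Qn ≤ L := by
    rcases Nat.eq_zero_or_pos Qn with h0 | hpos
    · rw [h0]; simp [hL0.le]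
    · exact Real.log_le_log (by exact_mod_cast hpos) (hQnx.trans hxcx)
  have hlogQn0 : 0 ≤ Real.log Qn := Real.log_natCast_nonneg Qn
  have hlam1 : ∀ q, |lam q| ≤ 1 := hlam.1
  -- the dyadic depth `K` with `L^{A+3} < 2^K ≤ 2 L^{A+3}`
  have hLA : 1 ≤ L ^ (A + 3) := Real.one_le_rpow hL1 (by linarith)
  obtain ⟨K, hPlow, hPup⟩ := exists_pow_two_near hLA
  have hP0 : (0 : ℝ) < 2 ^ K := by positivity
  -- the lowest point `yK = x / 2^K` and the bottom `m = x / (2 L^{A+3})`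
  set yK : ℝ := x / 2 ^ K with hyK
  set m : ℝ := x / (2 * L ^ (A + 3)) with hm
  have hm0 : 0 < 2 * L ^ (A + 3) := by positivity
  have hmyK : m ≤ yK := div_le_div_of_nonneg_left hx0 hP0 hPup
  have hyKup : yK ≤ x / L ^ (A + 3) := div_le_div_of_nonneg_left hx0 (by positivity) hPlow.le
  have hyKx : yK ≤ x := div_le_self hx0 (one_le_pow₀ one_le_two)
  have hm_ge : max x₁ 2 ≤ m := by
    rw [hm, le_div_iff₀ hm0]; linarith
  have hm2 : 2 ≤ m := (le_max_right _ _).trans hm_ge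
  have hm_sqrt : Real.sqrt x ≤ m := by
    rw [hm, le_div_iff₀ hm0]
    calc Real.sqrt x * (2 * L ^ (A + 3)) ≤ Real.sqrt x * Real.sqrt x := by
          refine mul_le_mul_of_nonneg_left ?_ (Real.sqrt_nonneg x)
          rw [Real.le_sqrt (by positivity) hx0]; exact he2
      _ = x := Real.mul_self_sqrt hx0
  have hlogm : L / 2 ≤ Real.log m := by
    have : Real.log (Real.sqrt x) = L / 2 := by
      rw [hL, Real.log_sqrt hx0]
    rw [← this]
    exact Real.log_le_log (Real.sqrt_pos.2 (by linarith)) hm_sqrt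
  -- level comparison: `x^{4/7−ε} ≤ m^{4/7−ε/2}`
  have hlevm : x ^ c ≤ m ^ (4 / 7 - ε / 2) := by
    have hce : 4 / 7 - ε / 2 = c + ε / 2 := by rw [hc]; ring
    rw [hce, hm, Real.div_rpow hx0 hm0.le, le_div_iff₀ (Real.rpow_pos_of_pos hm0 _),
      Real.rpow_add (by linarith : (0 : ℝ) < x)]
    refine mul_le_mul_of_nonneg_left ?_ (by positivity)
    have hbase : 1 ≤ 2 * L ^ (A + 3) := by linarith
    calc (2 * L ^ (A + 3)) ^ (c + ε / 2) ≤ (2 * L ^ (A + 3)) ^ (1 : ℝ) :=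
          Real.rpow_le_rpow_of_exponent_le hbase (by rw [hc]; linarith)
      _ = 2 * L ^ (A + 3) := Real.rpow_one _
      _ ≤ x ^ (ε / 2) := he3
  -- the dyadic hypothesis with a nonnegative constant, for `y ≥ max x₁ 1`
  have hdy : ∀ y : ℝ, max x₁ 1 ≤ y → ∀ lam : ℕ → ℝ, IsWellFactorable (y ^ (4 / 7 - ε / 2)) lam →
      |∑ q ∈ (Icc 1 ⌊y ^ (4 / 7 - ε / 2)⌋₊).filter (fun q : ℕ => IsCoprime (q : ℤ) a),
          lam q * dyadDisc q a y| ≤ C₁' * y / Real.log y ^ (A + 2) := by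
    intro y hy lam' hlam'
    have hy1 : 1 ≤ y := (le_max_right _ _).trans hy
    have hyx₁ : x₁ ≤ y := (le_max_left _ _).trans hy
    refine (hC₁ y hyx₁ lam' hlam').trans ?_
    have h0 : 0 ≤ y / Real.log y ^ (A + 2) :=
      div_nonneg (by linarith) (Real.rpow_nonneg (Real.log_nonneg hy1) _)
    calc C₁ * y / Real.log y ^ (A + 2) = C₁ * (y / Real.log y ^ (A + 2)) := by ring
      _ ≤ C₁' * (y / Real.log y ^ (A + 2)) := mul_le_mul_of_nonneg_right (le_max_left _ _) h0
      _ = C₁' * y / Real.log y ^ (A + 2) := by ring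
  -- basic facts on `yK`
  have hyK1 : 1 ≤ yK := by linarith
  have hyK0 : 0 ≤ yK := by linarith
  have hlogyK : Real.log yK ≤ L := Real.log_le_log (by linarith) hyKx
  have hlogyK0 : 0 ≤ Real.log yK := Real.log_nonneg hyK1
  -- Step A: the decomposition `T₁ + T₂ + T₃`
  have hdecomp : ∀ q : ℕ, lam q * (LevelOfDistribution.chebyshevPsiMod q (a : ZMod q) x - x / (Nat.totient q : ℝ)) =
      lam q * LevelOfDistribution.chebyshevPsiMod q (a : ZMod q) (x / 2 ^ K) +
        (∑ k ∈ range K, lam q * dyadDisc q a (x / 2 ^ (k + 1))) +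
        lam q * ((∑ n ∈ Ioc ⌊x / 2 ^ K⌋₊ ⌊x⌋₊, if n.Coprime q then Λ n else 0) /
          (Nat.totient q : ℝ) - x / (Nat.totient q : ℝ)) := by
    intro q
    have hdisc : ∀ y : ℝ, psiDyadMod q (a : ZMod q) y =
        dyadDisc q a y + psiDyadCoprime q y / (Nat.totient q : ℝ) := fun y => by
      unfold dyadDisc; ring
    rw [chebyshevPsiMod_eq_add_sum_psiDyadMod q _ hx0 K,
      Finset.sum_congr rfl fun k _ => hdisc (x / 2 ^ (k + 1)), Finset.sum_add_distrib,
      ← Finset.sum_div, sum_psiDyadCoprime_eq q hx0 K, ← Finset.mul_sum]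
    ring
  have htotal : ∑ q ∈ S, lam q * (LevelOfDistribution.chebyshevPsiMod q (a : ZMod q) x - x / (Nat.totient q : ℝ)) =
      (∑ q ∈ S, lam q * LevelOfDistribution.chebyshevPsiMod q (a : ZMod q) yK) +
        (∑ k ∈ range K, ∑ q ∈ S, lam q * dyadDisc q a (x / 2 ^ (k + 1))) +
        ∑ q ∈ S, lam q * ((∑ n ∈ Ioc ⌊yK⌋₊ ⌊x⌋₊, if n.Coprime q then Λ n else 0) /
          (Nat.totient q : ℝ) - x / (Nat.totient q : ℝ)) := by
    rw [Finset.sum_congr rfl fun q _ => hdecomp q, Finset.sum_add_distrib, Finset.sum_add_distrib,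
      Finset.sum_comm]
  -- Step B: `T₁ ≤ 3 x / L^A`
  have hT1 : |∑ q ∈ S, lam q * LevelOfDistribution.chebyshevPsiMod q (a : ZMod q) yK| ≤ 3 * x / L ^ A :=
    (abs_sum_mul_chebyshevPsiMod_le Qn _ hlam1 a hyK1).trans
      (reduction_T1_arith hL0 hL1 hx1 hyK0 hyKup hlogyK (Nat.cast_nonneg Qn) hQ47
        hlogQn hlogQn0 he4)
  -- Step B: `T₂ ≤ C₁' 2^{A+2} x / L^A`
  have hT2 : ∑ k ∈ range K, |∑ q ∈ S, lam q * dyadDisc q a (x / 2 ^ (k + 1))| ≤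
      C₁' * 2 ^ (A + 2) * x / L ^ A := by
    have hpiece : ∀ k ∈ range K, |∑ q ∈ S, lam q * dyadDisc q a (x / 2 ^ (k + 1))| ≤
        C₁' * 2 ^ (A + 2) * (x / 2 ^ (k + 1)) / L ^ (A + 2) := by
      intro k hk
      have hkK : k + 1 ≤ K := mem_range.1 hk
      have hyKy : yK ≤ x / 2 ^ (k + 1) :=
        div_le_div_of_nonneg_left hx0 (by positivity) (pow_le_pow_right₀ one_le_two hkK)
      have hmy : m ≤ x / 2 ^ (k + 1) := hmyK.trans hyKy
      have hmpos : 0 < m := by linarith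
      have hx₁y : max x₁ 1 ≤ x / 2 ^ (k + 1) :=
        (max_le_max le_rfl one_le_two).trans (hm_ge.trans hmy)
      have hlev : x ^ c ≤ (x / 2 ^ (k + 1)) ^ (4 / 7 - ε / 2) :=
        hlevm.trans (Real.rpow_le_rpow hmpos.le hmy (by linarith))
      have hlog : L / 2 ≤ Real.log (x / 2 ^ (k + 1)) := hlogm.trans (Real.log_le_log hmpos hmy)
      exact abs_dyadic_piece_le (a := a) (ε := ε) hC₁'0 (by linarith : 0 < A + 2) hdy hx₁y
        (hyK0.trans hyKy) hxc1 hlev hL0 hlog hlam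
    refine (Finset.sum_le_sum hpiece).trans ?_
    have hsum : ∑ k ∈ range K, C₁' * 2 ^ (A + 2) * (x / 2 ^ (k + 1)) / L ^ (A + 2) =
        C₁' * 2 ^ (A + 2) / L ^ (A + 2) * (x * (1 - 1 / 2 ^ K)) := by
      rw [← sum_range_div_two_pow_succ, Finset.mul_sum]
      refine Finset.sum_congr rfl fun k _ => ?_
      ring
    rw [hsum]
    exact reduction_T2_arith K hL0 hL1 hx0 hC₁'0
  -- Step B: `T₃ ≤ (4 CP' + 29) x / L^A`
  have hT3 : |∑ q ∈ S, lam q * ((∑ n ∈ Ioc ⌊yK⌋₊ ⌊x⌋₊, if n.Coprime q then Λ n else 0) /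
        (Nat.totient q : ℝ) - x / (Nat.totient q : ℝ))| ≤ (4 * CP' + 29) * x / L ^ A := by
    refine (abs_sum_mul_coprime_main_le Qn _ hlam1 hyK1 hyKx).trans ?_
    have hψx : |ψ x - x| ≤ CP' * x / L ^ (A + 2) := by
      refine (hCP x (by linarith)).trans ?_
      have h0 : 0 ≤ x / L ^ (A + 2) := by positivity
      calc CP * x / Real.log x ^ (A + 2) = CP * (x / L ^ (A + 2)) := by rw [hL]; ring
        _ ≤ CP' * (x / L ^ (A + 2)) := mul_le_mul_of_nonneg_right (le_max_left _ _) h0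
        _ = CP' * x / L ^ (A + 2) := by ring
    have hψyK : ψ yK ≤ 7 * (x / L ^ (A + 3)) := by
      refine (Chebyshev.psi_le_const_mul_self hyK0).trans ?_
      have hlog4 : Real.log 4 ≤ 3 := by
        have := Real.log_le_sub_one_of_pos (by norm_num : (0 : ℝ) < 4); linarith
      calc (Real.log 4 + 4) * yK ≤ 7 * yK := mul_le_mul_of_nonneg_right (by linarith) hyK0
        _ ≤ 7 * (x / L ^ (A + 3)) := by gcongr
    simpa only [hL] using reduction_T3_arith hL0 hL1 hx0 hψx hψyK hlogQn hlogQn0 he5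
  -- conclusion
  have habs : |∑ q ∈ S, lam q * (LevelOfDistribution.chebyshevPsiMod q (a : ZMod q) x - x / (Nat.totient q : ℝ))| ≤
      3 * x / L ^ A + C₁' * 2 ^ (A + 2) * x / L ^ A + (4 * CP' + 29) * x / L ^ A := by
    rw [htotal]
    refine (abs_add_le _ _).trans (add_le_add ((abs_add_le _ _).trans (add_le_add hT1 ?_)) hT3)
    exact (Finset.abs_sum_le_sum_abs _ _).trans hT2
  refine habs.trans (le_of_eq ?_)
  rw [hL]
  ring

/-- **Unsifting** (BFI §15 p. 244: in (15.1) "`z` is any number `< x`"): the sifted dyadic estimate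
for any sifting level `z(x) ≤ x` implies the unsifted one, `BFI.Theorem10Dyadic`.  The difference
consists of proper prime powers `p^k`, `k ≥ 2`, `p < z`, in `(x, 2x]`: on the progression side their
total over `q ≤ x^{4/7}` (even with a supremum over the residue) is `≪ x (log x)^{−A}` by
`Literature.NumberTheory.Sieve.eventually_sum_iSup_nonPrime_vonMangoldt_residue_le`, and on the main-term side
`ψ(2x) − ϑ(2x) ≤ 2√(2x) log 2x` against `∑_{q ≤ Q} 1/φ(q) ≤ (1 + log Q)²`. PROVED.
[cite: BombieriFriedlanderIwaniecActa1986, §15 (15.1) p. 244] -/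
theorem BFI.Theorem10Dyadic_of_sifted {z : ℝ → ℝ} (hz : ∀ᶠ x in atTop, z x ≤ x)
    (h : Theorem10DyadicSifted z) : Theorem10Dyadic := by
  intro a ha ε hε A hA
  obtain ⟨C, x₀, hC⟩ := h a ha ε hε A hA
  set C' : ℝ := max C 0 with hC'
  have hNP := (Filter.tendsto_id.const_mul_atTop (by norm_num : (0 : ℝ) < 2)).eventually
    (eventually_sum_iSup_nonPrime_vonMangoldt_residue_le (by norm_num : (0 : ℝ) < 3 / 7) A)
  have hev : ∀ᶠ x : ℝ in atTop, 2 ≤ x ∧ 32 ≤ Real.log x ∧ x₀ ≤ x ∧ z x ≤ x ∧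
      Real.log x ^ (A + 4) ≤ x ^ (1 / 2 : ℝ) ∧
      ∀ Q : ℕ, (Q : ℝ) ≤ (2 * x) ^ (1 - 3 / 7 : ℝ) →
        ∑ q ∈ Icc 1 Q, ⨆ u : (ZMod q)ˣ, ∑ n ∈ range (⌊2 * x⌋₊ + 1),
          (if n.Prime then 0 else if (n : ZMod q) = u then Λ n else 0) ≤
        2 * x / Real.log (2 * x) ^ A := by
    filter_upwards [eventually_ge_atTop (2 : ℝ), Real.tendsto_log_atTop.eventually_ge_atTop 32,
      eventually_ge_atTop x₀, hz, Literature.NumberTheory.Sieve.eventually_log_rpow_le_rpow (A + 4) one_half_pos, hNP]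
      with x h1 h2 h3 h4 h5 h6
    exact ⟨h1, h2, h3, h4, h5, fun Q hQ => by simpa only [id] using h6 Q hQ⟩
  obtain ⟨x₁, hx₁⟩ := Filter.eventually_atTop.1 hev
  refine ⟨C' + 3, x₁, fun x hx lam hlam => ?_⟩
  obtain ⟨hx2, hL32, hxx₀, hzx, hLx, hNPx⟩ := hx₁ x hx
  -- notation
  set L : ℝ := Real.log x with hL
  set c : ℝ := 4 / 7 - ε with hc
  set Qn : ℕ := ⌊x ^ c⌋₊ with hQn
  set S : Finset ℕ := (Icc 1 Qn).filter (fun q : ℕ => IsCoprime (q : ℤ) a) with hS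
  have hx1 : (1 : ℝ) ≤ x := by linarith
  have hx0 : (0 : ℝ) ≤ x := by linarith
  have hL0 : 0 < L := by linarith
  have hL1 : 1 ≤ L := by linarith
  have hLA0 : 0 < L ^ A := Real.rpow_pos_of_pos hL0 A
  have hlam1 : ∀ q, |lam q| ≤ 1 := hlam.1
  -- the moduli range against `(2x)^{4/7}` and `x`
  have hQnx : (Qn : ℝ) ≤ x ^ c := Nat.floor_le (by positivity)
  have hQn2x : (Qn : ℝ) ≤ (2 * x) ^ (1 - 3 / 7 : ℝ) := by
    refine hQnx.trans ?_
    calc x ^ c ≤ x ^ (1 - 3 / 7 : ℝ) := Real.rpow_le_rpow_of_exponent_le hx1 (by rw [hc]; linarith)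
      _ ≤ (2 * x) ^ (1 - 3 / 7 : ℝ) := Real.rpow_le_rpow hx0 (by linarith) (by norm_num)
  have hlogQn : Real.log Qn ≤ L := by
    rcases Nat.eq_zero_or_pos Qn with h0 | hpos
    · rw [h0]; simp [hL0.le]
    · refine Real.log_le_log (by exact_mod_cast hpos) (hQnx.trans ?_)
      calc x ^ c ≤ x ^ (1 : ℝ) := Real.rpow_le_rpow_of_exponent_le hx1 (by rw [hc]; linarith)
        _ = x := Real.rpow_one x
  have hlogQn0 : 0 ≤ Real.log Qn := Real.log_natCast_nonneg Qn
  -- Step 1: the sifted estimate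
  have h1 : |∑ q ∈ S, lam q * dyadDiscSifted q a (z x) x| ≤ C' * x / L ^ A := by
    refine (hC x hxx₀ lam hlam).trans ?_
    have h0 : 0 ≤ x / L ^ A := by positivity
    calc C * x / Real.log x ^ A = C * (x / L ^ A) := by rw [hL]; ring
      _ ≤ C' * (x / L ^ A) := mul_le_mul_of_nonneg_right (le_max_left _ _) h0
      _ = C' * x / L ^ A := by ring
  -- Step 2: the unsifting cost, modulus by modulus (over `q ∈ S`, all coprime to `a`)
  set NP : ℕ → ℝ := fun q => ∑ n ∈ range (⌊2 * x⌋₊ + 1),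
    (if n.Prime then 0 else if (n : ZMod q) = (a : ZMod q) then Λ n else 0) with hNPdef
  have hdiff : |(∑ q ∈ S, lam q * dyadDisc q a x) - ∑ q ∈ S, lam q * dyadDiscSifted q a (z x) x| ≤
      ∑ q ∈ S, NP q + ∑ q ∈ S, (ψ (2 * x) - θ (2 * x)) / (Nat.totient q : ℝ) := by
    rw [← Finset.sum_sub_distrib, ← Finset.sum_add_distrib]
    refine (Finset.abs_sum_le_sum_abs _ _).trans (Finset.sum_le_sum fun q hq => ?_)
    have hq1 : 1 ≤ q := (mem_Icc.1 (mem_filter.1 hq).1).1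
    rw [← mul_sub, abs_mul]
    have hd := abs_dyadDisc_sub_sifted_le hzx hq1 a
    have h0 : 0 ≤ |dyadDisc q a x - dyadDiscSifted q a (z x) x| := abs_nonneg _
    calc |lam q| * |dyadDisc q a x - dyadDiscSifted q a (z x) x|
        ≤ 1 * |dyadDisc q a x - dyadDiscSifted q a (z x) x| :=
          mul_le_mul_of_nonneg_right (hlam1 q) h0
      _ ≤ NP q + (ψ (2 * x) - θ (2 * x)) / (Nat.totient q : ℝ) := by rw [one_mul]; exact hd
  -- Step 3: the progression side via the supremum over reduced residues
  set SUP : ℕ → ℝ := fun q => ⨆ u : (ZMod q)ˣ, ∑ n ∈ range (⌊2 * x⌋₊ + 1),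
    (if n.Prime then 0 else if (n : ZMod q) = u then Λ n else 0) with hSUPdef
  have hterm0 : ∀ (q : ℕ) (u : ZMod q), 0 ≤ ∑ n ∈ range (⌊2 * x⌋₊ + 1),
      (if n.Prime then 0 else if (n : ZMod q) = u then Λ n else 0) := fun q u =>
    Finset.sum_nonneg fun n _ => by
      split_ifs <;> first | exact le_rfl | exact ArithmeticFunction.vonMangoldt_nonneg
  have hSUP0 : ∀ q, 0 ≤ SUP q := fun q =>
    le_ciSup_of_le (Set.finite_range _).bddAbove 1 (hterm0 q _)
  have hNP_le : ∑ q ∈ S, NP q ≤ 2 * x / L ^ A := by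
    have hsup : ∀ q ∈ S, NP q ≤ SUP q := by
      intro q hq
      obtain ⟨u, hu⟩ := (ZMod.coe_int_isUnit_iff_isCoprime a q).2 (mem_filter.1 hq).2
      have : NP q = ∑ n ∈ range (⌊2 * x⌋₊ + 1),
          (if n.Prime then 0 else if (n : ZMod q) = ((u : ZMod q)) then Λ n else 0) := by
        simp only [hNPdef, hu]
      rw [this]
      exact le_ciSup (f := fun u : (ZMod q)ˣ => ∑ n ∈ range (⌊2 * x⌋₊ + 1),
        (if n.Prime then 0 else if (n : ZMod q) = u then Λ n else 0))
        (Set.finite_range _).bddAbove u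
    calc ∑ q ∈ S, NP q ≤ ∑ q ∈ S, SUP q := Finset.sum_le_sum hsup
      _ ≤ ∑ q ∈ Icc 1 Qn, SUP q :=
          Finset.sum_le_sum_of_subset_of_nonneg (Finset.filter_subset _ _) fun q _ _ => hSUP0 q
      _ ≤ 2 * x / Real.log (2 * x) ^ A := hNPx Qn hQn2x
      _ ≤ 2 * x / L ^ A := by
          refine div_le_div_of_nonneg_left (by linarith) hLA0 ?_
          exact Real.rpow_le_rpow hL0.le (Real.log_le_log (by linarith) (by linarith)) hA.le
  -- Step 4: the main-term side
  have hMT_le : ∑ q ∈ S, (ψ (2 * x) - θ (2 * x)) / (Nat.totient q : ℝ) ≤ x / L ^ A := by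
    have hpt : 0 ≤ ψ (2 * x) - θ (2 * x) := sub_nonneg.2 (Chebyshev.theta_le_psi _)
    have hpt' : ψ (2 * x) - θ (2 * x) ≤ 8 * Real.sqrt x * L := by
      refine (Chebyshev.psi_sub_theta_le (by linarith : (1 : ℝ) ≤ 2 * x)).trans ?_
      have hs : Real.sqrt (2 * x) ≤ 2 * Real.sqrt x := by
        rw [Real.sqrt_le_left (by positivity)]
        nlinarith [Real.sq_sqrt hx0, Real.sqrt_nonneg x]
      have hl : Real.log (2 * x) ≤ 2 * L := by
        rw [Real.log_mul two_ne_zero (by linarith), hL]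
        have : Real.log 2 ≤ Real.log x := Real.log_le_log two_pos hx2
        linarith
      have hl0 : 0 ≤ Real.log (2 * x) := Real.log_nonneg (by linarith)
      calc 2 * Real.sqrt (2 * x) * Real.log (2 * x) ≤ 2 * (2 * Real.sqrt x) * (2 * L) := by
            gcongr
        _ = 8 * Real.sqrt x * L := by ring
    calc ∑ q ∈ S, (ψ (2 * x) - θ (2 * x)) / (Nat.totient q : ℝ)
        ≤ ∑ q ∈ Icc 1 Qn, (ψ (2 * x) - θ (2 * x)) / (Nat.totient q : ℝ) :=
          Finset.sum_le_sum_of_subset_of_nonneg (Finset.filter_subset _ _) fun q _ _ =>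
            div_nonneg hpt (Nat.cast_nonneg _)
      _ = (ψ (2 * x) - θ (2 * x)) * Literature.NumberTheory.Sieve.totientInvSum Qn := by
          rw [Literature.NumberTheory.Sieve.totientInvSum, Finset.mul_sum]
          refine Finset.sum_congr rfl fun q _ => ?_
          rw [div_eq_mul_inv]
      _ ≤ (8 * Real.sqrt x * L) * (4 * L ^ 2) := by
          refine mul_le_mul hpt' ((Literature.NumberTheory.Sieve.totientInvSum_le Qn).trans (by nlinarith))
            (Literature.NumberTheory.Sieve.totientInvSum_nonneg Qn) (by positivity)
      _ = 32 * Real.sqrt x * L ^ 3 := by ring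
      _ ≤ x / L ^ A := by
          rw [le_div_iff₀ hLA0]
          have hLA3 : L ^ A * L ^ 3 = L ^ (A + 3) := by
            rw [Real.rpow_add hL0, show (3 : ℝ) = ((3 : ℕ) : ℝ) by norm_num, Real.rpow_natCast]
          have hsq : Real.sqrt x * Real.sqrt x = x := Real.mul_self_sqrt hx0
          have hxhalf : x ^ (1 / 2 : ℝ) = Real.sqrt x := (Real.sqrt_eq_rpow x).symm
          have hLA4 : L ^ (A + 4) = L ^ (A + 3) * L := by
            rw [show A + 4 = (A + 3) + 1 by ring, Real.rpow_add hL0, Real.rpow_one]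
          -- 32 √x L³ L^A = 32 √x L^{A+3} ≤ √x · L · L^{A+3} = √x L^{A+4} ≤ √x √x = x
          calc 32 * Real.sqrt x * L ^ 3 * L ^ A = 32 * L ^ (A + 3) * Real.sqrt x := by
                rw [← hLA3]; ring
            _ ≤ L * L ^ (A + 3) * Real.sqrt x := by
                refine mul_le_mul_of_nonneg_right ?_ (Real.sqrt_nonneg x)
                exact mul_le_mul_of_nonneg_right hL32 (by positivity)
            _ = L ^ (A + 4) * Real.sqrt x := by rw [hLA4]; ring
            _ ≤ Real.sqrt x * Real.sqrt x := by
                rw [← hxhalf] at *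
                exact mul_le_mul_of_nonneg_right hLx (by positivity)
            _ = x := hsq
  -- conclusion
  have hmain : |∑ q ∈ S, lam q * dyadDisc q a x| ≤ C' * x / L ^ A + (2 * x / L ^ A + x / L ^ A) := by
    have := abs_sub_abs_le_abs_sub (∑ q ∈ S, lam q * dyadDisc q a x)
      (∑ q ∈ S, lam q * dyadDiscSifted q a (z x) x)
    linarith [hdiff.trans (add_le_add hNP_le hMT_le)]
  refine hmain.trans (le_of_eq ?_)
  rw [hL]; ring

end Literature.NumberTheory.Sieve
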